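import Summits.Langlands.Langlands.Theorems.ExtendedAdequacySplitCoreIrreducibleProductLiftingStubProductDescentTransportTensor

/-!
# CPR `ExtendedAdequacySplit.CoreIrreducibleProductLifting` (stmt-Langlands-27081), line `birth`, stub 1/5
# `stub_productDescentTransport` (T_Π) — part 4: the `Sym² ⊗ χ` branch reduced to its AUTOMORPHIC content; T_Π ⟸ two cuspidal lifts

Part 3 (`…StubProductDescentTransportTensor`, landed) discharged the Galois side of the `⊠` branch.  This file does the same for the
`Sym² ⊗ χ` branch: given cuspidal `π_σ` on `GL₂/E`, `π_χ` on `GL₁/E` with avatars `σ`, `χ`, and an automorphic `P` on `GL₃/E` whose Satake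
parameter at almost every `v` is `Sym² t_{π_σ,v} ⊙ t_{π_χ,v} = {c x², c xy, c y²}` (the Gelbart–Jacquet symmetric square lift twisted by `π_χ`),
EVERY a.e.-unramified `r : Γ_E → GL₃(ℚ̄_ℓ)` with `2·tr r = tr χ · ((tr σ)² + tr σ(g²))` is Satake–Frobenius compatible with `P` almost everywhere:
POINTWISE at each arithmetic Frobenius `s` (no symmetric-square representation is constructed): with `χ_{σ(s)} = (X - a)(X - b)`, `χ_{χ(s)} = X - d`,
the identity at `s^k` gives the power traces `tr r(s)^k = d^k(a^{2k} + a^k b^k + b^{2k})`, i.e. the power sums of `{d a², d ab, d b²}`, and Newton's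
identities over the algebraically closed `ℚ̄_ℓ` (tree `LadicLimit`) give `χ_{r(s)} = (X - d a²)(X - d ab)(X - d b²)` (`charpoly_eq_of_symmSq_twist_trace`,
`hasFrobCharpolyAt_of_symmSq_twist_trace`, `eventually_satakeFrobCompatibleAt_of_symmSq_twist_trace`).  Hence part 2's `hSymIrr` follows from ONE automorphic-existence
hypothesis (`symmSqTransportIrr_of_cuspidalSymmSqTwistLift`):

* `hGJ⊗` — **CUSPIDAL, L-ALGEBRAIC TWISTED SYMMETRIC SQUARE under Galois irreducibility**: for cuspidal L-algebraic `π_σ` on `GL₂(𝔸_E)` and `π_χ` on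
  `GL₁(𝔸_E)` with a.e.-compatible avatars `σ`, `χ` such that some IRREDUCIBLE `r` has `2·tr r = tr χ·((tr σ)² + tr σ(g²))`, there is a CUSPIDAL
  L-algebraic `P` on `GL₃(𝔸_E)` with `t_{P,v} = Sym² t_{π_σ,v} ⊙ t_{π_χ,v}` a.e. — Gelbart–Jacquet, Ann. Sci. ÉNS 11 (1978) Thm (9.3) (tree fact
  `GelbartJacquet_symmSq_cuspidal`: cuspidal `Sym²` lift absent a quadratic self-twist; the proviso follows from the irreducibility of
  `r ≃ χ ⊗ Sym² σ`: a self-twist makes `σ` induced and `Sym² σ` reducible), the twist by the Hecke character of `π_χ` (`GL₃ × GL₁ → GL₃`), and the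
  archimedean clause (L-algebraicity of the lift) — the riders not vendored in the tree.

**Net result of parts 1–4** (`stub_productDescentTransport_of_cuspidalLifts`): the registered stub T_Π holds GIVEN exactly two AUTOMORPHIC-EXISTENCE
statements `hGJ⊗`, `hRam⊠` (cuspidal L-algebraic `Sym² ⊗ GL₁` and `⊠` lifts under Galois irreducibility); all Galois-side plumbing, the induction
hypothesis, the Serre_w/W⁺ link, the irreducibility of `ρ|_E` and the solvable descent are kernel-checked.  No new definition; 0 sorry.
-/

set_option linter.dupNamespace false

namespace Summit.Langlands.Langlands.Theorems.CoreAdequacy.ExtAdequacy.ProductTransport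

open Filter IsDedekindDomain NumberField Polynomial
open scoped MatrixGroups Kronecker NumberField Classical
open Literature.NumberTheory.GaloisRepresentations
open Literature.NumberTheory.Automorphic
open Literature.NumberTheory.PAdicHodge
open Summit.Langlands.Langlands.Theses
open Summit.Langlands.Langlands.Theorems.IrreducibleOffSector (arithFrobPolyOfSatake_one_eq_prod_map)

/-! ## §1 Pointwise: the characteristic polynomial of `r(s)` from the `Sym² ⊗ χ` trace identity (Newton at one element) -/

/-- **`χ_{r(s)} = (X - d a²)(X - d ab)(X - d b²)`** for a representation `r` of a monoid with `2·tr r(g) = tr χ(g)·((tr σ(g))² + tr σ(g²))`, at an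
element `s` where `χ_{σ(s)} = (X - a)(X - b)` and `χ_{χ(s)} = X - d` (algebraically closed coefficients of characteristic `0`).  The identity at
`s^k` gives the power traces `tr r(s)^k = d^k (a^{2k} + a^k b^k + b^{2k})`, the power sums of `{d a², d ab, d b²}`; Newton's identities
(`LadicLimit.multiset_eq_of_psum_eq`, `matrix_trace_pow_eq_sum_roots_pow`) identify the root multiset of `χ_{r(s)}`.  No symmetric-square
representation is constructed. [cite: SerreLinearRepresentations1977, §1.5] -/
theorem charpoly_eq_of_symmSq_twist_trace {G : Type*} [Monoid G] {F : Type*} [Field F] [IsAlgClosed F] [CharZero F]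
    (r : G →* GL (Fin 3) F) (σ : G →* GL (Fin 2) F) (χ : G →* GL (Fin 1) F)
    (htr : ∀ g, 2 * ((r g : GL (Fin 3) F) : Matrix (Fin 3) (Fin 3) F).trace =
      ((χ g : GL (Fin 1) F) : Matrix (Fin 1) (Fin 1) F).trace *
        (((σ g : GL (Fin 2) F) : Matrix (Fin 2) (Fin 2) F).trace ^ 2 + ((σ (g * g) : GL (Fin 2) F) : Matrix (Fin 2) (Fin 2) F).trace))
    {s : G} {a b d : F}
    (hσ : ((σ s : GL (Fin 2) F) : Matrix (Fin 2) (Fin 2) F).charpoly = (X - C a) * (X - C b))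
    (hχ : ((χ s : GL (Fin 1) F) : Matrix (Fin 1) (Fin 1) F).charpoly = X - C d) :
    ((r s : GL (Fin 3) F) : Matrix (Fin 3) (Fin 3) F).charpoly = (X - C (d * a ^ 2)) * (X - C (d * (a * b))) * (X - C (d * b ^ 2)) := by
  classical
  -- root multisets of `σ(s)`, `χ(s)` and their power traces
  have hrootsσ : ((σ s : GL (Fin 2) F) : Matrix (Fin 2) (Fin 2) F).charpoly.roots = a ::ₘ {b} := by
    rw [hσ, roots_mul (mul_ne_zero (X_sub_C_ne_zero a) (X_sub_C_ne_zero b)), roots_X_sub_C, roots_X_sub_C,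
      Multiset.singleton_add]
  have hrootsχ : ((χ s : GL (Fin 1) F) : Matrix (Fin 1) (Fin 1) F).charpoly.roots = {d} := by
    rw [hχ, roots_X_sub_C]
  have hσpow : ∀ k : ℕ, ((((σ s : GL (Fin 2) F) : Matrix (Fin 2) (Fin 2) F)) ^ k).trace = a ^ k + b ^ k := fun k => by
    rw [LadicLimit.matrix_trace_pow_eq_sum_roots_pow, hrootsσ]
    simp
  have hχpow : ∀ k : ℕ, ((((χ s : GL (Fin 1) F) : Matrix (Fin 1) (Fin 1) F)) ^ k).trace = d ^ k := fun k => by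
    rw [LadicLimit.matrix_trace_pow_eq_sum_roots_pow, hrootsχ]
    simp
  -- power traces of `r(s)` from the identity at `s^k`
  have hrpow : ∀ k : ℕ, ((((r s : GL (Fin 3) F) : Matrix (Fin 3) (Fin 3) F)) ^ k).trace =
      d ^ k * (a ^ (k + k) + a ^ k * b ^ k + b ^ (k + k)) := fun k => by
    have h := htr (s ^ k)
    rw [← pow_add] at h
    simp only [map_pow, Units.val_pow_eq_pow_val, hσpow, hχpow] at h
    have h2 : (2 : F) ≠ 0 := two_ne_zero
    apply mul_left_cancel₀ h2
    rw [h]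
    ring
  -- Newton for `r(s)`
  obtain ⟨M, hM⟩ : ∃ M : Matrix (Fin 3) (Fin 3) F, ((r s : GL (Fin 3) F) : Matrix (Fin 3) (Fin 3) F) = M := ⟨_, rfl⟩
  rw [hM] at hrpow ⊢
  have hcard : Multiset.card M.charpoly.roots = 3 := by
    rw [← (IsAlgClosed.splits M.charpoly).natDegree_eq_card_roots, Matrix.charpoly_natDegree_eq_dim, Fintype.card_fin]
  have hu : Multiset.card (d * a ^ 2 ::ₘ d * (a * b) ::ₘ {d * b ^ 2} : Multiset F) = 3 := by simp
  have hroots : M.charpoly.roots = d * a ^ 2 ::ₘ d * (a * b) ::ₘ {d * b ^ 2} :=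
    LadicLimit.multiset_eq_of_psum_eq hcard hu fun j _ _ => by
      rw [← LadicLimit.matrix_trace_pow_eq_sum_roots_pow, hrpow j]
      simp only [Multiset.map_cons, Multiset.map_singleton, Multiset.sum_cons, Multiset.sum_singleton]
      ring
  rw [← prod_multiset_X_sub_C_of_monic_of_roots_card_eq (Matrix.charpoly_monic M) (IsAlgClosed.card_roots_eq_natDegree), hroots]
  simp only [Multiset.map_cons, Multiset.map_singleton, Multiset.prod_cons, Multiset.prod_singleton]
  ring

/-- **Frobenius polynomials of `r` from the `Sym² ⊗ χ` trace identity** (Galois form of `charpoly_eq_of_symmSq_twist_trace`): if the arithmetic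
Frobenii at `v` have characteristic polynomials `arithFrobPolyOfSatake ι q 1 {x, y}` on `σ` and `… {c}` on `χ`, and `2·tr r = tr χ·((tr σ)² + tr σ(g²))`
on `Γ_E`, then they have characteristic polynomial `arithFrobPolyOfSatake ι q 1 {c x², c xy, c y²}` on `r` (the dictionary `t ↦ ι⁻¹(t⁻¹)` is
multiplicative). [cite: BuzzardGeeLMS2014, §2.1] -/
theorem hasFrobCharpolyAt_of_symmSq_twist_trace {E : Type} [Field E] [NumberField E] {ℓ : ℕ} [Fact ℓ.Prime] (ι : PadicAlgCl ℓ ≃+* ℂ)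
    {v : HeightOneSpectrum (𝓞 E)} (q : ℕ)
    {σ : FramedGaloisRep E (PadicAlgCl ℓ) 2} {χ : FramedGaloisRep E (PadicAlgCl ℓ) 1} {r : FramedGaloisRep E (PadicAlgCl ℓ) 3} {x y c : ℂ}
    (hσ : σ.HasFrobCharpolyAt v (arithFrobPolyOfSatake ι q 1 {x, y}))
    (hχ : χ.HasFrobCharpolyAt v (arithFrobPolyOfSatake ι q 1 {c}))
    (htr : ∀ g : Field.absoluteGaloisGroup E,
      2 * FramedRep.trace r g = FramedRep.trace χ g * (FramedRep.trace σ g ^ 2 + FramedRep.trace σ (g * g))) :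
    r.HasFrobCharpolyAt v (arithFrobPolyOfSatake ι q 1 {c * x ^ 2, c * (x * y), c * y ^ 2}) := by
  intro 𝔓 h𝔓 s hs
  have hσs := hσ 𝔓 h𝔓 s hs
  have hχs := hχ 𝔓 h𝔓 s hs
  rw [arithFrobPolyOfSatake_one_eq_prod_map] at hσs hχs ⊢
  simp only [Multiset.insert_eq_cons, Multiset.map_cons, Multiset.map_singleton, Multiset.prod_cons,
    Multiset.prod_singleton] at hσs hχs ⊢
  have key := charpoly_eq_of_symmSq_twist_trace
    (r : Field.absoluteGaloisGroup E →* GL (Fin 3) (PadicAlgCl ℓ)) (σ : Field.absoluteGaloisGroup E →* GL (Fin 2) (PadicAlgCl ℓ))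
    (χ : Field.absoluteGaloisGroup E →* GL (Fin 1) (PadicAlgCl ℓ)) htr hσs hχs
  refine (key.trans ?_ : ((r s : GL (Fin 3) (PadicAlgCl ℓ)) : Matrix (Fin 3) (Fin 3) (PadicAlgCl ℓ)).charpoly = _)
  simp only [mul_inv, ← inv_pow, map_mul, map_pow]
  ring

/-! ## §2 The `Sym² ⊗ χ` branch: Galois side discharged -/

/-- **Every a.e.-unramified `r` with `2·tr r = tr χ·((tr σ)² + tr σ(g²))` is compatible with a twisted symmetric square lift of the partners of `σ`, `χ`.**
If `P` on `GL₃(𝔸_E)` has Satake parameter `{c x², c xy, c y²}` at almost every `v` where `t_{π_σ,v} = {x, y}`, `t_{π_χ,v} = {c}`, and `σ` (resp. `χ`)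
is compatible with `π_σ` (resp. `π_χ`) a.e., then such an `r` is compatible with `P` a.e. (`hasFrobCharpolyAt_of_symmSq_twist_trace`; Satake parameters of
`GL₂`/`GL₁` data are pairs/singletons, `HasSatakeParamAt.card_eq`). [cite: Gelbart1997, Thm. 5.3.2] -/
theorem eventually_satakeFrobCompatibleAt_of_symmSq_twist_trace {E : Type} [Field E] [NumberField E]
    {h2 : isCompact_glFiniteIntegralLevel 2 E} {h1 : isCompact_glFiniteIntegralLevel 1 E}
    {h3 : isCompact_glFiniteIntegralLevel 3 E} {ℓ : ℕ} [Fact ℓ.Prime] (ι : PadicAlgCl ℓ ≃+* ℂ)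
    (πσ : AutomorphicRepData (AutomorphyDatum.gl 2 E h2)) (πχ : AutomorphicRepData (AutomorphyDatum.gl 1 E h1))
    (P : AutomorphicRepData (AutomorphyDatum.gl 3 E h3))
    (hP : ∀ᶠ v : HeightOneSpectrum (𝓞 E) in cofinite, ∀ x y c : ℂ,
      πσ.HasSatakeParamAt v {x, y} → πχ.HasSatakeParamAt v {c} → P.HasSatakeParamAt v {c * x ^ 2, c * (x * y), c * y ^ 2})
    {σ : FramedGaloisRep E (PadicAlgCl ℓ) 2} {χ : FramedGaloisRep E (PadicAlgCl ℓ) 1} {r : FramedGaloisRep E (PadicAlgCl ℓ) 3}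
    (hσ : ∀ᶠ v : HeightOneSpectrum (𝓞 E) in cofinite, SatakeFrobCompatibleAt ι πσ σ v)
    (hχ : ∀ᶠ v : HeightOneSpectrum (𝓞 E) in cofinite, SatakeFrobCompatibleAt ι πχ χ v)
    (hunr : ∀ᶠ v : HeightOneSpectrum (𝓞 E) in cofinite, r.IsUnramifiedAt v)
    (htr : ∀ g : Field.absoluteGaloisGroup E,
      2 * FramedRep.trace r g = FramedRep.trace χ g * (FramedRep.trace σ g ^ 2 + FramedRep.trace σ (g * g))) :
    ∀ᶠ v : HeightOneSpectrum (𝓞 E) in cofinite, SatakeFrobCompatibleAt ι P r v := by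
  filter_upwards [hP, hσ, hχ, hunr] with v hPv ⟨α, hα, _, hcpσ⟩ ⟨γ, hγ, _, hcpχ⟩ hur
  obtain ⟨x, y, rfl⟩ := Multiset.card_eq_two.mp hα.card_eq
  obtain ⟨c, rfl⟩ := Multiset.card_eq_one.mp hγ.card_eq
  exact ⟨_, hPv x y c hα hγ, hur, hasFrobCharpolyAt_of_symmSq_twist_trace ι v.residueCard hcpσ hcpχ htr⟩

/-- **The irreducible-form `Sym² ⊗ χ` transport ⟸ the cuspidal L-algebraic twisted symmetric square under Galois irreducibility** (`hGJ⊗`, module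
docstring): the hypothesis `hSymIrr` of part 2 with its Galois side DISCHARGED.  Proof: `n = 3` (`rank_eq_three_of_symSq_shadow`); partners `π_σ`, `π_χ`
at the level structures `isCompact_glFiniteIntegralLevel_holds`; `hGJ⊗` gives the cuspidal L-algebraic `P`; `r` is compatible with `P` a.e. by
`eventually_satakeFrobCompatibleAt_of_symmSq_twist_trace`. -/
theorem symmSqTransportIrr_of_cuspidalSymmSqTwistLift
    (hGJ : ∀ (E : Type) [Field E] [NumberField E] (h2 : isCompact_glFiniteIntegralLevel 2 E) (h1 : isCompact_glFiniteIntegralLevel 1 E)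
      (h3 : isCompact_glFiniteIntegralLevel 3 E) (ℓ : ℕ) [Fact ℓ.Prime] (ι : PadicAlgCl ℓ ≃+* ℂ)
      (πσ : CuspidalAutomorphicRepData 2 E h2) (πχ : CuspidalAutomorphicRepData 1 E h1)
      (σ : FramedGaloisRep E (PadicAlgCl ℓ) 2) (χ : FramedGaloisRep E (PadicAlgCl ℓ) 1) (r : FramedGaloisRep E (PadicAlgCl ℓ) 3),
      πσ.1.IsLAlgebraic → πχ.1.IsLAlgebraic →
      (∀ᶠ v : HeightOneSpectrum (𝓞 E) in cofinite, SatakeFrobCompatibleAt ι πσ.1 σ v) →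
      (∀ᶠ v : HeightOneSpectrum (𝓞 E) in cofinite, SatakeFrobCompatibleAt ι πχ.1 χ v) →
      r.toGaloisRep.IsIrreducible →
      (∀ g : Field.absoluteGaloisGroup E,
        2 * FramedRep.trace r g = FramedRep.trace χ g * (FramedRep.trace σ g ^ 2 + FramedRep.trace σ (g * g))) →
      ∃ P : CuspidalAutomorphicRepData 3 E h3, P.1.IsLAlgebraic ∧
        ∀ᶠ v : HeightOneSpectrum (𝓞 E) in cofinite, ∀ x y c : ℂ,
          πσ.1.HasSatakeParamAt v {x, y} → πχ.1.HasSatakeParamAt v {c} →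
            P.1.HasSatakeParamAt v {c * x ^ 2, c * (x * y), c * y ^ 2}) :
    ∀ (E : Type) [Field E] [NumberField E] (n : ℕ) (ℓ : ℕ) [Fact ℓ.Prime] (ι : PadicAlgCl ℓ ≃+* ℂ)
      (r : FramedGaloisRep E (PadicAlgCl ℓ) n) (σ : FramedGaloisRep E (PadicAlgCl ℓ) 2) (χ : FramedGaloisRep E (PadicAlgCl ℓ) 1),
      r.toGaloisRep.IsIrreducible → LieDefect.Geometric r → σ.toGaloisRep.IsIrreducible → LieDefect.Geometric σ → LieDefect.Geometric χ →
      (∀ g : Field.absoluteGaloisGroup E,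
        2 * FramedRep.trace r g = FramedRep.trace χ g * (FramedRep.trace σ g ^ 2 + FramedRep.trace σ (g * g))) →
      (∀ hcpt₂ : isCompact_glFiniteIntegralLevel 2 E, ∃ π : CuspidalAutomorphicRepData 2 E hcpt₂, π.1.IsLAlgebraic ∧
        ∀ᶠ v : HeightOneSpectrum (𝓞 E) in cofinite, SatakeFrobCompatibleAt ι π.1 σ v) →
      (∀ hcpt₁ : isCompact_glFiniteIntegralLevel 1 E, ∃ π : CuspidalAutomorphicRepData 1 E hcpt₁, π.1.IsLAlgebraic ∧
        ∀ᶠ v : HeightOneSpectrum (𝓞 E) in cofinite, SatakeFrobCompatibleAt ι π.1 χ v) →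
      ∀ hcptE : isCompact_glFiniteIntegralLevel n E, ∃ π : CuspidalAutomorphicRepData n E hcptE, π.1.IsLAlgebraic ∧
        ∀ᶠ v : HeightOneSpectrum (𝓞 E) in cofinite, SatakeFrobCompatibleAt ι π.1 r v := by
  intro E _ _ n ℓ _ ι r σ χ hirr hgeo _ _ _ htr hautσ hautχ hcptE
  have hn3 : n = 3 := ExtAdequacy.Product.rank_eq_three_of_symSq_shadow _ htr
  subst hn3
  obtain ⟨πσ, hLσ, hcσ⟩ := hautσ (isCompact_glFiniteIntegralLevel_holds 2 E)
  obtain ⟨πχ, hLχ, hcχ⟩ := hautχ (isCompact_glFiniteIntegralLevel_holds 1 E)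
  obtain ⟨P, hPL, hPT⟩ := hGJ E (isCompact_glFiniteIntegralLevel_holds 2 E) (isCompact_glFiniteIntegralLevel_holds 1 E) hcptE ℓ ι
    πσ πχ σ χ r hLσ hLχ hcσ hcχ hirr htr
  exact ⟨P, hPL, eventually_satakeFrobCompatibleAt_of_symmSq_twist_trace ι πσ.1 πχ.1 P.1 hPT hcσ hcχ hgeo.1 htr⟩

/-! ## §3 T_Π ⟸ {`hGJ⊗`, `hRam⊠`}: the registered stub from two automorphic-existence statements -/

/-- **T_Π from the two CUSPIDAL LIFTS** — the registered stub VERBATIM (`OdlyzkoWorldAutomorphy → TransOdlyzkoAutomorphy → SatakeAvatarExistence →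
CliffordSolvableDescent → CoreIrreducibleProductLifting`) from `hGJ⊗` (cuspidal L-algebraic twisted symmetric square under Galois irreducibility;
Gelbart–Jacquet Thm (9.3) + GL₁ twist + archimedean clause) and `hRam⊠` (cuspidal L-algebraic Rankin–Selberg product under Galois irreducibility;
Ramakrishnan Thm M + criterion + archimedean clause).  All Galois-side content of the print chain Π1–Π6 is kernel-checked in parts 1–4. -/
theorem stub_productDescentTransport_of_cuspidalLifts
    (hGJ : ∀ (E : Type) [Field E] [NumberField E] (h2 : isCompact_glFiniteIntegralLevel 2 E) (h1 : isCompact_glFiniteIntegralLevel 1 E)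
      (h3 : isCompact_glFiniteIntegralLevel 3 E) (ℓ : ℕ) [Fact ℓ.Prime] (ι : PadicAlgCl ℓ ≃+* ℂ)
      (πσ : CuspidalAutomorphicRepData 2 E h2) (πχ : CuspidalAutomorphicRepData 1 E h1)
      (σ : FramedGaloisRep E (PadicAlgCl ℓ) 2) (χ : FramedGaloisRep E (PadicAlgCl ℓ) 1) (r : FramedGaloisRep E (PadicAlgCl ℓ) 3),
      πσ.1.IsLAlgebraic → πχ.1.IsLAlgebraic →
      (∀ᶠ v : HeightOneSpectrum (𝓞 E) in cofinite, SatakeFrobCompatibleAt ι πσ.1 σ v) →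
      (∀ᶠ v : HeightOneSpectrum (𝓞 E) in cofinite, SatakeFrobCompatibleAt ι πχ.1 χ v) →
      r.toGaloisRep.IsIrreducible →
      (∀ g : Field.absoluteGaloisGroup E,
        2 * FramedRep.trace r g = FramedRep.trace χ g * (FramedRep.trace σ g ^ 2 + FramedRep.trace σ (g * g))) →
      ∃ P : CuspidalAutomorphicRepData 3 E h3, P.1.IsLAlgebraic ∧
        ∀ᶠ v : HeightOneSpectrum (𝓞 E) in cofinite, ∀ x y c : ℂ,
          πσ.1.HasSatakeParamAt v {x, y} → πχ.1.HasSatakeParamAt v {c} →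
            P.1.HasSatakeParamAt v {c * x ^ 2, c * (x * y), c * y ^ 2})
    (hRam : ∀ (E : Type) [Field E] [NumberField E] (h2 : isCompact_glFiniteIntegralLevel 2 E) (h4 : isCompact_glFiniteIntegralLevel 4 E)
      (ℓ : ℕ) [Fact ℓ.Prime] (ι : PadicAlgCl ℓ ≃+* ℂ) (π₁ π₂ : CuspidalAutomorphicRepData 2 E h2)
      (σ₁ σ₂ : FramedGaloisRep E (PadicAlgCl ℓ) 2) (r : FramedGaloisRep E (PadicAlgCl ℓ) 4),
      π₁.1.IsLAlgebraic → π₂.1.IsLAlgebraic →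
      (∀ᶠ v : HeightOneSpectrum (𝓞 E) in cofinite, SatakeFrobCompatibleAt ι π₁.1 σ₁ v) →
      (∀ᶠ v : HeightOneSpectrum (𝓞 E) in cofinite, SatakeFrobCompatibleAt ι π₂.1 σ₂ v) →
      r.toGaloisRep.IsIrreducible → (∀ g : Field.absoluteGaloisGroup E, FramedRep.trace r g = FramedRep.trace σ₁ g * FramedRep.trace σ₂ g) →
      ∃ P : CuspidalAutomorphicRepData 4 E h4, P.1.IsLAlgebraic ∧
        ∀ᶠ v : HeightOneSpectrum (𝓞 E) in cofinite, ∀ α β : Multiset ℂ,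
          π₁.1.HasSatakeParamAt v α → π₂.1.HasSatakeParamAt v β → P.1.HasSatakeParamAt v (satakeTensor α β)) :
    ExtendedAdequacySplit.OdlyzkoWorldAutomorphy → ExtendedAdequacySplit.TransOdlyzkoAutomorphy →
      ExtendedAdequacySplit.SatakeAvatarExistence → ExtendedAdequacySplit.CliffordSolvableDescent →
        ExtendedAdequacySplit.CoreIrreducibleProductLifting :=
  stub_productDescentTransport_of_irreducibleTransport (symmSqTransportIrr_of_cuspidalSymmSqTwistLift hGJ)
    (tensorTransportIrr_of_cuspidalTensorLift hRam)

end Summit.Langlands.Langlands.Theorems.CoreAdequacy.ExtAdequacy.ProductTransport
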